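import Mathlib
import Summits.NavierStokesRegularity.NavierStokesRegularity.Theorems.ScenarioCensusPeriodicSlabEstimate
import Summits.NavierStokesRegularity.NavierStokesRegularity.Theorems.ScenarioCensusPeriodicSlabRegularity
import Literature.Analysis.FluidPDE.KNSSLineInvariantLiouville
import HarnessLib

/-!
# Census row S7 (bounded steady flows in the periodic slab, case (d)): the Liouville theorem

Support file for the scenario census of `NavierStokesRegularity` (cell `pub/ns-census`, row S7).
**Theorem** (Bang–Gui–Wang–Xie, J. Fluid Mech. 1005 (2025) A6 = arXiv:2205.13259, Thm 1.4 (d);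
the second conjunct of the tree FACT
`Literature.Analysis.FluidPDE.BangGuiWangXie2025_periodicSlab_liouville`, verbatim under its
hypotheses): a smooth steady Navier–Stokes flow `(U, P)` on `ℝ³` with viscosity `ν > 0`
(`IsLerayProfile ν 0 U P`, `U, P ∈ C^∞`), axially `L`-periodic and bounded with
`sup ‖U‖ < 2πν/L`, is constant (`periodicSlab_liouville_small`). NO symmetry is assumed.

Proof (the printed §5 Step 4, assembled from the sibling files): by `…Regularity`, all derivatives
of `U` and `∇P` are bounded and `w = ∂₃U`, `q = ∂₃P` solve the linearised system; by
`…Estimate`, the period energy `E(r) = ∫_{zSlab L 0 ∩ {ρ<r}} |Dw|²` satisfies the dyadic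
inequality with `ν − M L/(2π) > 0` (sharp Wirtinger constant), hence `E ≡ 0`
(`saintVenant_dyadic`); so `Dw ≡ 0` (continuity + periodicity), `w` is constant, and the constant
is `0` because `∫₀ᴸ ∂₃U = U(x + L e₃) − U(x) = 0`; thus `U` is invariant under axial translations
(`2½`-dimensional) and, being a bounded steady flow, a bounded ancient mild solution
(`steady_oseenMild_identity`), so it is constant by the tree's `2½`D Liouville theorem
`Literature.Analysis.FluidPDE.apply_eq_apply_zero_of_invariant_along` (KNSS 2009, Thm 5.1 road)
— exactly as the printed proof ends with "[KNSS]".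

No summit statement is proved in this file; the census value of row S7 is the lead's call.

## References

* J. Bang, C. Gui, Y. Wang, C. Xie, J. Fluid Mech. 1005 (2025) A6 = arXiv:2205.13259, Thm 1.4 (d),
  proof §5 Step 4. [BangGuiWangXie2025]
* G. Koch, N. Nadirashvili, G. Seregin, V. Šverák, Acta Math. 203 (2009) = arXiv:0709.3599,
  Thm 5.1 and §4. [KochNadirashviliSereginSverak2009]
-/

-- the summit and its single problem share the name (D-0017 nested layout)
set_option linter.dupNamespace false

noncomputable section

open MeasureTheory Set Function Filter InnerProductSpace
open scoped Topology ENNReal NNReal RealInnerProductSpace Laplacian ContDiff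

namespace Summit.NavierStokesRegularity.NavierStokesRegularity.Theorems.ScenarioCensus.PeriodicSlab

open Literature.Analysis Literature.Analysis.FluidPDE

/-! ### Periodicity and bounds of the differentiated pressure -/

/-- Iterated derivatives of an axially periodic function are axially periodic. -/
theorem isAxiallyPeriodic_iteratedFDeriv {F : Type*} [NormedAddCommGroup F] [NormedSpace ℝ F]
    {L : ℝ} {V : EuclideanSpace ℝ (Fin 3) → F} (hper : IsAxiallyPeriodic L V) (n : ℕ) :
    IsAxiallyPeriodic L (iteratedFDeriv ℝ n V) := by
  intro x
  have hfun : (fun y => V (y + L • EuclideanSpace.single 2 (1 : ℝ))) = V := funext fun y => hper y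
  have h := iteratedFDeriv_comp_add_right (𝕜 := ℝ) (f := V) n (L • EuclideanSpace.single 2 (1 : ℝ)) x
  rw [hfun] at h
  exact h.symm

/-- For a steady classical flow with axially periodic velocity: the pressure GRADIENT is axially
periodic (`∇P = νΔU − (U·∇)U`; the pressure itself need not be), hence so is `q = ∂₃P`, and
`|∂₃P| ≤ ‖∇P‖`. -/
theorem steady_pressure_partial {ν L : ℝ}
    {U : EuclideanSpace ℝ (Fin 3) → EuclideanSpace ℝ (Fin 3)} {P : EuclideanSpace ℝ (Fin 3) → ℝ}
    (h : IsSteadyClassicalNS ν 0 U P) (hper : IsAxiallyPeriodic L U) :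
    IsAxiallyPeriodic L (fun y => fderiv ℝ P y eZ) ∧
      ∀ x, |fderiv ℝ P x eZ| ≤ ‖gradient P x‖ := by
  set b := stdOrthonormalBasis ℝ (EuclideanSpace ℝ (Fin 3)) with hb
  have hgrad : ∀ y, gradient P y = ν • (Δ U) y - convect U U y := fun y => by
    have hm := h.momentum y
    rw [Pi.zero_apply, add_zero] at hm
    rw [hm]; abel
  have hq : ∀ y, fderiv ℝ P y eZ = ⟪gradient P y, eZ⟫ := fun y => by
    rw [gradient, InnerProductSpace.toDual_symm_apply]
  have hΔper : IsAxiallyPeriodic L (Δ U) := fun x => by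
    rw [InnerProductSpace.laplacian_eq_iteratedFDeriv_orthonormalBasis U b]
    simp only [isAxiallyPeriodic_iteratedFDeriv hper 2 x]
  have hconvper : ∀ x, convect U U (x + L • EuclideanSpace.single 2 (1 : ℝ)) = convect U U x :=
    fun x => by simp only [convect_apply, isAxiallyPeriodic_fderiv hper x, hper x]
  refine ⟨fun x => ?_, fun x => ?_⟩
  · simp only [hq, hgrad]
    rw [hΔper x, hconvper x]
  · rw [hq, ← Real.norm_eq_abs]
    have heZ : ‖(eZ : EuclideanSpace ℝ (Fin 3))‖ = 1 := by simp [eZ]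
    calc ‖⟪gradient P x, eZ⟫‖ ≤ ‖gradient P x‖ * ‖(eZ : EuclideanSpace ℝ (Fin 3))‖ := norm_inner_le_norm _ _
      _ = ‖gradient P x‖ := by rw [heZ, mul_one]

/-! ### From vanishing period energies to a vanishing derivative -/

/-- A nonnegative continuous axially `L`-periodic function whose integrals over the period pieces
`zSlab L 0 ∩ {ρ < r}` vanish for all `r ≥ 1` vanishes identically. -/
theorem eq_zero_of_setIntegral_zSlab_eq_zero {L : ℝ} (hL : 0 < L) {F : EuclideanSpace ℝ (Fin 3) → ℝ}
    (hFc : Continuous F) (hF0 : ∀ x, 0 ≤ F x) (hFper : IsAxiallyPeriodic L F) {B : ℝ}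
    (hFB : ∀ x, ‖F x‖ ≤ B)
    (hint : ∀ r, 1 ≤ r → ∫ x in zSlab L 0 ∩ {x | cylRadius x < r}, F x = 0) :
    ∀ x, F x = 0 := by
  -- (1) `F = 0` on the open period pieces `{0 < x₂ < L} ∩ {ρ < r}`
  have hopen : ∀ r, 1 ≤ r → ∀ x : EuclideanSpace ℝ (Fin 3), 0 < x 2 → x 2 < L → cylRadius x < r →
      F x = 0 := by
    intro r hr x h0 h1 hxr
    set O : Set (EuclideanSpace ℝ (Fin 3)) := {y | 0 < y 2 ∧ y 2 < L} ∩ {y | cylRadius y < r} with hO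
    have hOopen : IsOpen O := by
      have h2c : Continuous fun y : EuclideanSpace ℝ (Fin 3) => y 2 :=
        (EuclideanSpace.proj (2 : Fin 3) : EuclideanSpace ℝ (Fin 3) →L[ℝ] ℝ).continuous
      exact ((isOpen_lt continuous_const h2c).inter (isOpen_lt h2c continuous_const)).inter
        (isOpen_lt continuous_cylRadius continuous_const)
    have hOsub : O ⊆ zSlab L 0 ∩ {y | cylRadius y < r} := fun y hy => by
      refine ⟨?_, hy.2⟩
      rw [mem_zSlab]; simp only [Int.cast_zero, zero_mul, zero_add, one_mul]
      exact ⟨hy.1.1.le, hy.1.2⟩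
    have hI : IntegrableOn F (zSlab L 0 ∩ {y | cylRadius y < r}) volume :=
      integrableOn_zSlab_inter_cyl_of_bound hL (by linarith) hFc hFB
    have hae : F =ᵐ[volume.restrict (zSlab L 0 ∩ {y | cylRadius y < r})] 0 :=
      (setIntegral_eq_zero_iff_of_nonneg_ae (Eventually.of_forall hF0) hI).1 (hint r hr)
    have haeO : F =ᵐ[volume.restrict O] 0 := ae_restrict_of_ae_restrict_of_subset hOsub hae
    have hEq : EqOn F 0 O :=
      Measure.eqOn_open_of_ae_eq haeO hOopen hFc.continuousOn continuousOn_const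
    exact hEq ⟨⟨h0, h1⟩, hxr⟩
  -- (2) points with `x₂ = 0` by continuity
  have hbdry : ∀ x : EuclideanSpace ℝ (Fin 3), x 2 = 0 → F x = 0 := by
    intro x hx2
    set r : ℝ := cylRadius x + 1 with hr
    have hr1 : 1 ≤ r := by have := cylRadius_nonneg x; linarith
    -- the sequence `x + (L/(n+2)) e₃ → x` lies in the open piece
    have hlim : Tendsto (fun n : ℕ => x + (L / ((n : ℝ) + 2)) • eZ) atTop (𝓝 x) := by
      have h1 : Tendsto (fun n : ℕ => L / ((n : ℝ) + 2)) atTop (𝓝 0) := by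
        have := tendsto_const_div_atTop_nhds_zero_nat L |>.comp (tendsto_add_atTop_nat 2)
        refine this.congr fun n => ?_
        simp [Nat.cast_add]
      have h2 : Tendsto (fun n : ℕ => x + (L / ((n : ℝ) + 2)) • (eZ : EuclideanSpace ℝ (Fin 3)))
          atTop (𝓝 (x + (0 : ℝ) • eZ)) :=
        tendsto_const_nhds.add (h1.smul_const _)
      rwa [zero_smul, add_zero] at h2
    have hvals : ∀ n : ℕ, F (x + (L / ((n : ℝ) + 2)) • eZ) = 0 := fun n => by
      have hn : (0 : ℝ) < (n : ℝ) + 2 := by positivity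
      refine hopen r hr1 _ ?_ ?_ ?_
      · rw [apply_two_add_smul_eZ, hx2, zero_add]; positivity
      · rw [apply_two_add_smul_eZ, hx2, zero_add, div_lt_iff₀ hn]; nlinarith
      · have : cylRadius (x + (L / ((n : ℝ) + 2)) • eZ) = cylRadius x := by simp [cylRadius, eZ]
        rw [this, hr]; linarith
    have hFlim : Tendsto (fun n : ℕ => F (x + (L / ((n : ℝ) + 2)) • eZ)) atTop (𝓝 (F x)) :=
      (hFc.tendsto x).comp hlim
    have : Tendsto (fun _ : ℕ => (0 : ℝ)) atTop (𝓝 (F x)) := hFlim.congr hvals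
    exact tendsto_nhds_unique this tendsto_const_nhds
  -- (3) reduce a general point into the strip `0 ≤ x₂ < L` by an integer period
  intro x
  set k : ℤ := ⌊x 2 / L⌋ with hk
  set y : EuclideanSpace ℝ (Fin 3) := x + (-((k : ℝ) * L)) • eZ with hy
  have hyx : F x = F y := by
    have hp := hFper.periodic_int_mul_smul_eZ k
    have : y + ((k : ℝ) * L) • eZ = x := by rw [hy, add_assoc, ← add_smul]; simp
    rw [← this, hp y]
  have hy2 : y 2 = x 2 - (k : ℝ) * L := by rw [hy, apply_two_add_smul_eZ]; ring
  have hy0 : 0 ≤ y 2 := by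
    rw [hy2, sub_nonneg, hk]
    have := Int.floor_le (x 2 / L)
    rwa [le_div_iff₀ hL] at this
  have hyL : y 2 < L := by
    rw [hy2, hk]
    have := Int.lt_floor_add_one (x 2 / L)
    rw [div_lt_iff₀ hL] at this
    linarith
  rw [hyx]
  rcases hy0.eq_or_lt with h0 | h0
  · exact hbdry y h0.symm
  · exact hopen (cylRadius y + 1) (by have := cylRadius_nonneg y; linarith) y h0 hyL (by linarith)

/-! ### The Liouville theorem -/

/-- **Bang–Gui–Wang–Xie 2025, Thm 1.4 (d): bounded steady flows in the periodic slab with small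
period–Reynolds number are constant.** Let `ν > 0`, `L > 0`, and let `(U, P)` be a smooth steady
solution of the unforced Navier–Stokes system on `ℝ³` (`IsLerayProfile ν 0 U P`, `U, P ∈ C^∞`),
axially `L`-periodic (`IsAxiallyPeriodic L U`) and bounded with `sup ‖U‖ < 2πν/L`. Then `U` is a
constant vector. This is the second conjunct of the named fact
`Literature.Analysis.FluidPDE.BangGuiWangXie2025_periodicSlab_liouville` under its hypotheses,
now a theorem of the tree (no symmetry assumed; the constant `2π` is Wirtinger's). -/
theorem periodicSlab_liouville_small {ν L : ℝ} (hν : 0 < ν) (hL : 0 < L)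
    {U : EuclideanSpace ℝ (Fin 3) → EuclideanSpace ℝ (Fin 3)} {P : EuclideanSpace ℝ (Fin 3) → ℝ}
    (hprof : IsLerayProfile ν 0 U P) (hU : ContDiff ℝ (⊤ : ℕ∞) U) (hP : ContDiff ℝ (⊤ : ℕ∞) P)
    (hbd : ∃ M : ℝ, M < 2 * Real.pi * ν / L ∧ ∀ x, ‖U x‖ ≤ M) (hper : IsAxiallyPeriodic L U) :
    ∃ C : EuclideanSpace ℝ (Fin 3), U = fun _ => C := by
  obtain ⟨M, hMlt, hM⟩ := hbd
  have hst : IsSteadyClassicalNS ν 0 U P := isSteadyClassicalNS_of_isLerayProfile hprof hU hP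
  -- derivative bounds and the differentiated system
  obtain ⟨K₁, K₂, K₃, -, -, -, hK⟩ := steady_derivative_bounds hν hst hM
  obtain ⟨hwS, hqS, hdivw, hpde⟩ := steady_differentiated_system hst eZ
  obtain ⟨hqper, hqbd⟩ := steady_pressure_partial hst hper
  set w : EuclideanSpace ℝ (Fin 3) → EuclideanSpace ℝ (Fin 3) := fun y => fderiv ℝ U y eZ with hw
  set q : EuclideanSpace ℝ (Fin 3) → ℝ := fun y => fderiv ℝ P y eZ with hq
  have hq1 : ContDiff ℝ 1 q := contDiff_infty.1 hqS 1
  have hK₃ : ∀ x, |q x| ≤ K₃ := fun x => (hqbd x).trans (hK x).2.2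
  have hML : M * L / (2 * Real.pi) ≤ ν := by
    rw [div_le_iff₀ (by positivity)]
    have := (lt_div_iff₀ hL).1 hMlt
    nlinarith [Real.pi_pos]
  have hν' : 0 < ν - M * L / (2 * Real.pi) := by
    rw [sub_pos, div_lt_iff₀ (by positivity)]
    have := (lt_div_iff₀ hL).1 hMlt
    nlinarith [Real.pi_pos]
  -- the period energies
  set F : EuclideanSpace ℝ (Fin 3) → ℝ := fun x => frobeniusNormSq (fderiv ℝ w x) with hF
  set E : ℝ → ℝ := fun r => ∫ x in zSlab L 0 ∩ {x | cylRadius x < r}, F x with hE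
  obtain ⟨γ, a, c, hγ, ha, hc, hineq⟩ := energy_dyadic_estimate hν hL hML hU hq1 hst.divFree hdivw
    hpde hper hqper hM (fun x => (hK x).1) (fun x => (hK x).2.1) hK₃ E (fun r => rfl)
  -- properties of `F` and `E`
  have hU2 : ContDiff ℝ 2 U := contDiff_infty.1 hU 2
  have hw1 : ContDiff ℝ 1 w := contDiff_infty.1 hwS 1
  have hFc : Continuous F := continuous_frobeniusNormSq_fderiv hw1 one_ne_zero
  have hF0 : ∀ x, 0 ≤ F x := fun x => frobeniusNormSq_nonneg _
  have hFB : ∀ x, ‖F x‖ ≤ 3 * K₂ ^ 2 := fun x => by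
    rw [Real.norm_of_nonneg (hF0 x)]; exact (partial_bounds hU2 (fun y => (hK y).2.1) x).2.1
  have hwper : IsAxiallyPeriodic L w := fun y => by
    show fderiv ℝ U (y + L • EuclideanSpace.single 2 1) eZ = fderiv ℝ U y eZ
    rw [isAxiallyPeriodic_fderiv hper y]
  have hFper : IsAxiallyPeriodic L F := fun x => by
    simp only [hF, isAxiallyPeriodic_fderiv hwper x]
  have hEint : ∀ r, 0 < r → IntegrableOn F (zSlab L 0 ∩ {x | cylRadius x < r}) volume :=
    fun r hr => integrableOn_zSlab_inter_cyl_of_bound hL hr hFc hFB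
  have hmono : ∀ r s, 1 ≤ r → r ≤ s → E r ≤ E s := fun r s hr hrs =>
    setIntegral_mono_set (hEint s (by linarith)) (Eventually.of_forall fun x => hF0 x)
      (Eventually.of_forall fun x hx => ⟨hx.1, lt_of_lt_of_le hx.2 hrs⟩)
  have hE0 : ∀ r, 1 ≤ r → 0 ≤ E r := fun r _ =>
    setIntegral_nonneg ((measurableSet_zSlab L 0).inter
      (isOpen_lt continuous_cylRadius continuous_const).measurableSet) fun x _ => hF0 x
  have hEA : ∀ r, 1 ≤ r → E r ≤ 3 * K₂ ^ 2 * (8 * L) * r ^ 2 := by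
    intro r hr
    have hr0 : 0 < r := by linarith
    have hvol := volume_zSlab_inter_cyl_le hL hr0
    have hfin : volume (zSlab L 0 ∩ {x | cylRadius x < r}) ≠ ⊤ :=
      (lt_of_le_of_lt hvol ENNReal.ofReal_lt_top).ne
    have hmeas : MeasurableSet (zSlab L 0 ∩ {x : EuclideanSpace ℝ (Fin 3) | cylRadius x < r}) :=
      (measurableSet_zSlab L 0).inter (isOpen_lt continuous_cylRadius continuous_const).measurableSet
    calc E r ≤ ∫ x in zSlab L 0 ∩ {x | cylRadius x < r}, (3 * K₂ ^ 2 : ℝ) := by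
          refine setIntegral_mono_on (hEint r hr0) ?_ hmeas fun x _ => ?_
          · exact integrableOn_const hfin
          · have := hFB x; rwa [Real.norm_of_nonneg (hF0 x)] at this
      _ = (volume (zSlab L 0 ∩ {x | cylRadius x < r})).toReal * (3 * K₂ ^ 2) := by
          rw [setIntegral_const, smul_eq_mul, measureReal_def]
      _ ≤ (8 * L * r ^ 2) * (3 * K₂ ^ 2) :=
          mul_le_mul_of_nonneg_right (ENNReal.toReal_le_of_le_ofReal (by positivity) hvol)
            (by positivity)
      _ = 3 * K₂ ^ 2 * (8 * L) * r ^ 2 := by ring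
  -- `E ≡ 0` by the dyadic lemma
  have hEzero : ∀ r, 1 ≤ r → E r = 0 :=
    saintVenant_dyadic hν' hγ ha hc hmono hE0 hEA hineq
  -- `Dw ≡ 0`
  have hFzero : ∀ x, F x = 0 :=
    eq_zero_of_setIntegral_zSlab_eq_zero hL hFc hF0 hFper hFB hEzero
  set b := EuclideanSpace.basisFun (Fin 3) ℝ with hb
  have hDw : ∀ x, fderiv ℝ w x = 0 := by
    intro x
    have hcoord : ∀ i, fderiv ℝ w x (b i) = 0 := fun i => by
      have h1 := norm_apply_sq_le_frobeniusNormSq b (fderiv ℝ w x) i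
      have h2 : frobeniusNormSq (fderiv ℝ w x) = 0 := hFzero x
      rw [h2] at h1
      have h3 : ‖fderiv ℝ w x (b i)‖ ^ 2 = 0 := le_antisymm h1 (sq_nonneg _)
      exact norm_eq_zero.1 (pow_eq_zero_iff two_ne_zero |>.1 h3)
    ext v
    -- expand `v` in the basis
    have hv : v = ∑ i, ⟪b i, v⟫ • b i := (b.sum_repr' v).symm
    rw [hv, map_sum]
    simp [map_smul, hcoord]
  -- `w` is constant, and the constant vanishes by periodicity
  have hwd : Differentiable ℝ w := hw1.differentiable one_ne_zero
  have hwconst : ∀ x, w x = w 0 := fun x => is_const_of_fderiv_eq_zero hwd hDw x 0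
  have hUd : Differentiable ℝ U := (contDiff_infty.1 hU 1).differentiable one_ne_zero
  have hw0 : w 0 = 0 := by
    have hftc : ∫ s in (0 : ℝ)..L, fderiv ℝ U ((0 : EuclideanSpace ℝ (Fin 3)) + s • eZ) eZ =
        U ((0 : EuclideanSpace ℝ (Fin 3)) + L • eZ) - U ((0 : EuclideanSpace ℝ (Fin 3)) + (0 : ℝ) • eZ) :=
      intervalIntegral.integral_eq_sub_of_hasDerivAt (fun s _ => hasDerivAt_comp_add_smul_eZ hUd 0 s)
        ((hw1.continuous.comp (continuous_const.add (continuous_id.smul continuous_const))).intervalIntegrable _ _)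
    have hrhs : U ((0 : EuclideanSpace ℝ (Fin 3)) + L • eZ) - U ((0 : EuclideanSpace ℝ (Fin 3)) + (0 : ℝ) • eZ) = 0 := by
      rw [zero_smul, add_zero, isAxiallyPeriodic_add_smul_eZ hper 0, sub_self]
    have hlhs : ∫ s in (0 : ℝ)..L, fderiv ℝ U ((0 : EuclideanSpace ℝ (Fin 3)) + s • eZ) eZ = L • w 0 := by
      have : (fun s : ℝ => fderiv ℝ U ((0 : EuclideanSpace ℝ (Fin 3)) + s • eZ) eZ) = fun _ => w 0 :=
        funext fun s => hwconst _
      rw [this, intervalIntegral.integral_const, sub_zero]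
    rw [hlhs, hrhs] at hftc
    exact (smul_eq_zero.1 hftc).resolve_left hL.ne'
  have hwzero : ∀ x, w x = 0 := fun x => by rw [hwconst x, hw0]
  -- `U` is invariant under axial translations
  have hinvU : ∀ (x : EuclideanSpace ℝ (Fin 3)) (δ : ℝ), U (x + δ • eZ) = U x := by
    intro x δ
    have hg : Differentiable ℝ fun s : ℝ => U (x + s • eZ) := fun s =>
      (hasDerivAt_comp_add_smul_eZ hUd x s).differentiableAt
    have hg' : ∀ s : ℝ, deriv (fun s : ℝ => U (x + s • eZ)) s = 0 := fun s => by
      rw [(hasDerivAt_comp_add_smul_eZ hUd x s).deriv]; exact hwzero _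
    have := is_const_of_deriv_eq_zero hg hg' δ 0
    simpa using this
  -- the `2½`-dimensional Liouville theorem for the rescaled flow `ν⁻¹ U`
  have h1 : IsSteadyClassicalNS 1 0 (ν⁻¹ • U) (ν⁻¹ ^ 2 • P) := by
    simpa [inv_mul_cancel₀ hν.ne'] using hst.smul ν⁻¹
  have hVbd : ∀ x, ‖(ν⁻¹ • U) x‖ ≤ |ν⁻¹| * M := fun x => by
    rw [Pi.smul_apply, norm_smul, Real.norm_eq_abs]
    exact mul_le_mul_of_nonneg_left (hM x) (abs_nonneg _)
  have hVc : Continuous (ν⁻¹ • U) := h1.smooth_velocity.continuous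
  have hanc : IsBoundedAncientMildSolution 1 (fun _ : ℝ => ν⁻¹ • U) := by
    refine isBoundedAncientMildSolution_of_oseen one_pos ((hVc.comp continuous_snd).continuousOn)
      ⟨|ν⁻¹| * M, fun _ _ x => hVbd x⟩ (fun t _ => ?_) (fun s t hst _ x => ?_)
    · exact VectorCalculus.IsDivFree.isWeaklyDivFree_holds h1.divFree
        (contDiff_infty.1 h1.smooth_velocity 1)
    · rw [one_mul]; exact steady_oseenMild_identity h1 hVbd s t hst x
  have he : (eZ : EuclideanSpace ℝ (Fin 3)) ≠ 0 := by
    intro h0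
    have : (eZ : EuclideanSpace ℝ (Fin 3)) 2 = 0 := by rw [h0]; rfl
    simp [eZ] at this
  have hinvV : ∀ t : ℝ, t < 0 → ∀ (x : EuclideanSpace ℝ (Fin 3)) (δ : ℝ),
      (fun _ : ℝ => ν⁻¹ • U) t (x + δ • eZ) = (fun _ : ℝ => ν⁻¹ • U) t x := fun t _ x δ => by
    simp only [Pi.smul_apply, hinvU x δ]
  have hconst := apply_eq_apply_zero_of_invariant_along he hanc ((hVc.comp continuous_snd).continuousOn)
    hinvV (-1) (by norm_num)
  refine ⟨U 0, funext fun x => ?_⟩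
  have hx : (ν⁻¹ • U) x = (ν⁻¹ • U) 0 := hconst x
  simp only [Pi.smul_apply] at hx
  have := congrArg (fun v => ν • v) hx
  simpa [smul_smul, mul_inv_cancel₀ hν.ne'] using this

end Summit.NavierStokesRegularity.NavierStokesRegularity.Theorems.ScenarioCensus.PeriodicSlab

end
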